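import Literature.Probability.RandomPlanarGeometry.HexSAWPolygonMadrasBootstrap
import HarnessLib

/-!
# Madras' doubling bootstrap on the honeycomb lattice, edition 2: an abstract sequence, and a PAIR of output lengths
# (`c√N·q_N(ℍ)² ≤ q_{2N+K}(ℍ) + q_{2N+K+2}(ℍ)` still gives `q_N(ℍ) ≤ A·N^{−1/2}·μ_ℍ^N`)

Topic `Literature/Probability/RandomPlanarGeometry` (lane «pcv-sawmu», LINE «HEX-MADRAS», a-p4 g12; continues the TREE file
`HexSAWPolygonMadrasBootstrap.lean` (`HexBW.hexPolygonNumber_le_rpow_of_joinIneq`: ONE output length `2N + K`)).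

Why.  On `ℍ` the capless junctions of the line (one brick for the aligned contact, a staggered double brick for the gap-3 contacts, an
S-shaped triple brick for the row-offset contacts) add `K ∈ {2, 4, 6, 8}` sites, i.e. two classes mod 4; the family assembly
(`joinIneqHex_of_family`, monotonicity `q_n ≤ q_{n+4}`) therefore yields the join inequality with a PAIR of output lengths,
`c·√N·q_N² ≤ q_{2N+K} + q_{2N+K+2}`.  This file shows that the pair form has the same consequence.  Route: the TREE proof is
repeated verbatim for an ABSTRACT sequence `f` (hypotheses: `f ≥ 0`, `f = 0` on the odd integers `≥ 3`, `f(2m) > 0` for large `m`,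
`log f(2n)/(2n) → log μ`, the join inequality), and applied to `f n := q_n + q_{n+2}`, for which the pair inequality and
`q_n ≤ q_{n+4}` give the single-length inequality `(c/4)·√N·f(N)² ≤ f(2N + K + 4)`.

Sources.  N. Madras, J. Stat. Phys. 78 (1995) 681–699 [Madras1995LatticeAnimalsExponent], §2 (the a-priori bound from the join
inequality, on `ℤ²`); A. Hammond, arXiv:1504.05286 [Hammond2015SAPJoining], §2 p. 4 and §4.1 (arXiv v5); N. Madras and G. Slade,
*The Self-Avoiding Walk* (1993) [MadrasSlade1993], Theorem 3.2.3 (3.2.3) p. 64 (monotonicity in the length; here the tree's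
`HexBW.hexPolygonNumber_le_add_four`).  Label (lane): CONSOLIDATION-BY-TRANSFER / lane plumbing — no new fact is claimed.

## What is proved (namespace `…SAW.HexBW`)
* `rpow_bound_of_joinIneq_abstract` — the bootstrap for an abstract sequence `f` with growth constant `μ ≥ 1`;
* `tendsto_log_hexPolygonNumber_pair_div` — `log (q_{2n} + q_{2n+2}) / (2n) → log μ_ℍ`;
* **`hexPolygonNumber_le_rpow_of_joinIneq_pair`** — `c√N q_N² ≤ q_{2N+K} + q_{2N+K+2}` (even `N ≥ N₀`, `K` even, `c > 0`) implies
  `∃ A, ∀ N ≥ 1, q_N(ℍ) ≤ A · N^{−1/2} · μ_ℍ^N`; `…_sqrt_…` with `μ_ℍ = √(2+√2)`.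
-/

noncomputable section

open Filter Topology Finset Literature.Probability.LatticeModels Literature.Analysis.Asymptotics

namespace Literature.Probability.RandomPlanarGeometry.SAW

namespace HexBW

/-! ### The bootstrap for an abstract sequence -/

/-- **Madras' doubling bootstrap, abstract form.**  Let `f : ℕ → ℝ` be non-negative, vanish on the odd integers `≥ 3`, be positive on
the large even integers, with `log f(2n)/(2n) → log μ` (`μ ≥ 1`), and satisfy the join inequality `c·√N·f(N)² ≤ f(2N + K)` for the even
`N ≥ N₀` (`c > 0`, `K` even).  Then `f(N) ≤ A · N^{−1/2} · μ^N` for all `N ≥ 1`.  (Proof = the TREE proof of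
`hexPolygonNumber_le_rpow_of_joinIneq` with `q_N(ℍ)` replaced by `f`: auxiliary sequence `a_M = c · f(2(M − K/2))`,
`(√M a_M)² ≤ √(2M) a_{2M}`, `a_M^{1/M} → μ²`, `Madras1995_doubling_polynomial` with `θ = 1/2`.)
[cite: Madras1995LatticeAnimalsExponent, §2 (primary, not held: the a-priori bound from the superadditivity-type inequality)]
[cite: Hammond2015SAPJoining, §2 (arXiv v5 p. 4)] -/
theorem rpow_bound_of_joinIneq_abstract {f : ℕ → ℝ} {μ c : ℝ} {K N₀ m₀ : ℕ} (hμ1 : 1 ≤ μ) (hc : 0 < c) (hK : Even K)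
    (hf0 : ∀ n, 0 ≤ f n) (hfodd : ∀ n, 3 ≤ n → Odd n → f n = 0) (hfpos : ∀ m, m₀ ≤ m → 0 < f (2 * m))
    (hflim : Tendsto (fun n : ℕ => Real.log (f (2 * n)) / ((2 * n : ℕ) : ℝ)) atTop (𝓝 (Real.log μ)))
    (hJ : ∀ N : ℕ, N₀ ≤ N → Even N → c * Real.sqrt N * f N ^ 2 ≤ f (2 * N + K)) :
    ∃ A : ℝ, ∀ N : ℕ, 1 ≤ N → f N ≤ A * (N : ℝ) ^ (-(1 / 2 : ℝ)) * μ ^ N := by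
  obtain ⟨k, hk⟩ := hK
  have hμ0 : 0 < μ := lt_of_lt_of_le one_pos hμ1
  set q : ℕ → ℝ := f with hqdef
  have hq0 : ∀ N, 0 ≤ q N := hf0
  -- the threshold
  set M₁ : ℕ := N₀ + 2 * k + m₀ + 26 with hM₁
  -- the auxiliary sequence `a_M = c · q_{2(M−k)}`
  set a : ℕ → ℝ := fun M => if M₁ ≤ M then c * q (2 * (M - k)) else 0 with hadef
  have ha0 : ∀ n, 1 ≤ n → 0 ≤ a n := fun n _ => by
    simp only [hadef]; split_ifs
    · exact mul_nonneg hc.le (hq0 _)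
    · exact le_rfl
  have ha_of_ge : ∀ M, M₁ ≤ M → a M = c * q (2 * (M - k)) := fun M hM => by simp only [hadef]; rw [if_pos hM]
  have hqpos_even : ∀ M, M₁ ≤ M → 0 < q (2 * (M - k)) := fun M hM => hfpos (M - k) (by omega)
  -- (hsq): `(√M a_M)² ≤ √(2M) a_{2M}`
  have hsq : ∀ M : ℕ, 1 ≤ M → (((M : ℝ) ^ (1 / 2 : ℝ)) * a M) ^ 2 ≤ ((2 * M : ℕ) : ℝ) ^ (1 / 2 : ℝ) * a (2 * M) := by
    intro M hM1
    by_cases hM : M₁ ≤ M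
    · have h2M : M₁ ≤ 2 * M := by omega
      rw [ha_of_ge M hM, ha_of_ge (2 * M) h2M, ← Real.sqrt_eq_rpow, ← Real.sqrt_eq_rpow]
      -- the join inequality at `n = 2(M−k)`
      have hn₀ : N₀ ≤ 2 * (M - k) := by omega
      have hJ' := hJ (2 * (M - k)) hn₀ ⟨M - k, by ring⟩
      rw [show 2 * (2 * (M - k)) + K = 2 * (2 * M - k) by omega] at hJ'
      have hnpos : (0 : ℝ) < ((2 * (M - k) : ℕ) : ℝ) := by exact_mod_cast (show 0 < 2 * (M - k) by omega)
      have hsqrtn : 0 < Real.sqrt ((2 * (M - k) : ℕ) : ℝ) := Real.sqrt_pos.2 hnpos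
      -- `q_n² ≤ q_{2(2M−k)} / (c √n)`
      have hq2 : q (2 * (M - k)) ^ 2 ≤ q (2 * (2 * M - k)) / (c * Real.sqrt ((2 * (M - k) : ℕ) : ℝ)) := by
        rw [le_div_iff₀ (by positivity)]
        calc q (2 * (M - k)) ^ 2 * (c * Real.sqrt ((2 * (M - k) : ℕ) : ℝ))
            = c * Real.sqrt ((2 * (M - k) : ℕ) : ℝ) * q (2 * (M - k)) ^ 2 := by ring
          _ ≤ q (2 * (2 * M - k)) := hJ'
      -- `M ≤ √(2M) √n` since `M² ≤ 2M · 2(M−k)` iff `4k ≤ 3M`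
      have hgeo : (M : ℝ) ≤ Real.sqrt ((2 * M : ℕ) : ℝ) * Real.sqrt ((2 * (M - k) : ℕ) : ℝ) := by
        rw [← Real.sqrt_mul (by positivity)]
        apply Real.le_sqrt_of_sq_le
        have h1 : ((M : ℕ) : ℝ) ≤ 2 * ((2 * (M - k) : ℕ) : ℝ) := by
          have : M ≤ 2 * (2 * (M - k)) := by omega
          exact_mod_cast this
        have hM0 : (0 : ℝ) ≤ M := Nat.cast_nonneg _
        calc ((M : ℝ)) ^ 2 = (M : ℝ) * M := sq _
          _ ≤ (M : ℝ) * (2 * ((2 * (M - k) : ℕ) : ℝ)) := mul_le_mul_of_nonneg_left h1 hM0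
          _ = ((2 * M : ℕ) : ℝ) * ((2 * (M - k) : ℕ) : ℝ) := by push_cast; ring
      calc (Real.sqrt (M : ℝ) * (c * q (2 * (M - k)))) ^ 2 = (M : ℝ) * c ^ 2 * q (2 * (M - k)) ^ 2 := by
            rw [mul_pow, Real.sq_sqrt (Nat.cast_nonneg _)]; ring
        _ ≤ (M : ℝ) * c ^ 2 * (q (2 * (2 * M - k)) / (c * Real.sqrt ((2 * (M - k) : ℕ) : ℝ))) :=
            mul_le_mul_of_nonneg_left hq2 (by positivity)
        _ = (M : ℝ) / Real.sqrt ((2 * (M - k) : ℕ) : ℝ) * (c * q (2 * (2 * M - k))) := by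
            field_simp
        _ ≤ Real.sqrt ((2 * M : ℕ) : ℝ) * (c * q (2 * (2 * M - k))) := by
            apply mul_le_mul_of_nonneg_right _ (mul_nonneg hc.le (hq0 _))
            rw [div_le_iff₀ hsqrtn]; exact hgeo
    · -- below the threshold `a_M = 0`
      have : a M = 0 := by simp only [hadef]; rw [if_neg hM]
      rw [this, mul_zero, zero_pow two_ne_zero]
      exact mul_nonneg (Real.rpow_nonneg (Nat.cast_nonneg _) _) (ha0 _ (by omega))
  -- (hlim): `a_n^{1/n} → μ²`
  have hKlim : Tendsto (fun n : ℕ => n - k) atTop atTop := tendsto_sub_atTop_nat k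
  have hlog : Tendsto (fun n : ℕ => Real.log (a n) / n) atTop (𝓝 (Real.log (μ ^ 2))) := by
    -- `log a_n / n = log c / n + (log q_{2(n−k)} / (2(n−k))) · (2(n−k)/n)`
    have h1 : Tendsto (fun n : ℕ => Real.log c / n) atTop (𝓝 0) :=
      tendsto_const_nhds.div_atTop tendsto_natCast_atTop_atTop
    have h2 : Tendsto (fun n : ℕ => Real.log (q (2 * (n - k))) / ((2 * (n - k) : ℕ) : ℝ)) atTop (𝓝 (Real.log μ)) :=
      hflim.comp hKlim
    have h3 : Tendsto (fun n : ℕ => (((2 * (n - k) : ℕ) : ℝ)) / n) atTop (𝓝 2) := by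
      have h31 : Tendsto (fun n : ℕ => (2 : ℝ) - (2 * k : ℝ) / n) atTop (𝓝 (2 - 0)) :=
        tendsto_const_nhds.sub (tendsto_const_nhds.div_atTop tendsto_natCast_atTop_atTop)
      rw [sub_zero] at h31
      refine h31.congr' ?_
      filter_upwards [eventually_ge_atTop (k + 1)] with n hn
      have hn0 : (n : ℝ) ≠ 0 := by exact_mod_cast (show n ≠ 0 by omega)
      rw [Nat.cast_mul, Nat.cast_sub (by omega)]
      push_cast
      field_simp
    have h4 := h1.add (h2.mul h3)
    rw [zero_add, show Real.log μ * 2 = Real.log (μ ^ 2) by rw [Real.log_pow]; push_cast; ring] at h4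
    refine h4.congr' ?_
    filter_upwards [eventually_ge_atTop (M₁ + 1)] with n hn
    have hqpos : 0 < q (2 * (n - k)) := hqpos_even n (by omega)
    have hn0 : (n : ℝ) ≠ 0 := by exact_mod_cast (show n ≠ 0 by omega)
    have hnK0 : ((2 * (n - k) : ℕ) : ℝ) ≠ 0 := by exact_mod_cast (show 2 * (n - k) ≠ 0 by omega)
    rw [ha_of_ge n (by omega), Real.log_mul hc.ne' hqpos.ne']
    field_simp
  have hlim : Tendsto (fun n : ℕ => a n ^ (1 / (n : ℝ))) atTop (𝓝 (μ ^ 2)) := by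
    have hexp := (Real.continuous_exp.tendsto _).comp hlog
    rw [Real.exp_log (by positivity : (0 : ℝ) < μ ^ 2)] at hexp
    refine hexp.congr' ?_
    filter_upwards [eventually_ge_atTop (M₁ + 1)] with n hn
    have hqpos : 0 < q (2 * (n - k)) := hqpos_even n (by omega)
    have hapos : 0 < a n := by rw [ha_of_ge n (by omega)]; exact mul_pos hc hqpos
    simp only [Function.comp]
    rw [Real.rpow_def_of_pos hapos, one_div, ← div_eq_mul_inv]
  -- apply the doubling lemma with `θ = 1/2`, `λ = μ²`
  have hmain : ∀ N : ℕ, 1 ≤ N → a N ≤ (N : ℝ) ^ (-(1 / 2 : ℝ)) * (μ ^ 2) ^ N :=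
    fun N hN => Madras1995_doubling_polynomial ha0 hsq hlim hN
  -- constants
  set N₁ : ℕ := 2 * M₁ with hN₁
  set B : ℝ := ∑ j ∈ range N₁, q j * j with hB
  have hB0 : 0 ≤ B := Finset.sum_nonneg fun j _ => mul_nonneg (hq0 j) (Nat.cast_nonneg _)
  refine ⟨Real.sqrt 2 * μ ^ (2 * k) / c + B, fun N hN => ?_⟩
  have hN0 : (0 : ℝ) < N := by exact_mod_cast (show 0 < N by omega)
  have hrpow : (N : ℝ) ^ (-(1 / 2 : ℝ)) = 1 / Real.sqrt N := by
    rw [Real.rpow_neg hN0.le, ← Real.sqrt_eq_rpow, one_div]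
  have hsqrtN : 0 < Real.sqrt N := Real.sqrt_pos.2 hN0
  have hN1 : (1 : ℝ) ≤ N := by exact_mod_cast hN
  have hsqrt_le : Real.sqrt (N : ℝ) ≤ N := by
    calc Real.sqrt (N : ℝ) ≤ Real.sqrt ((N : ℝ) ^ 2) := Real.sqrt_le_sqrt (by nlinarith)
      _ = N := Real.sqrt_sq hN0.le
  have hA10 : 0 ≤ Real.sqrt 2 * μ ^ (2 * k) / c := by positivity
  have hfac0 : 0 ≤ (N : ℝ) ^ (-(1 / 2 : ℝ)) * μ ^ N := by positivity
  by_cases hbig : N₁ ≤ N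
  · rcases Nat.even_or_odd N with ⟨m, hm⟩ | hodd
    · -- even `N = 2m`, `M := m + k ≥ M₁`: `c q_N = a_M ≤ M^{-1/2} μ^{2M} ≤ √2 N^{-1/2} μ^{2k} μ^N`
      have hMge : M₁ ≤ m + k := by omega
      have h1 := hmain (m + k) (by omega)
      rw [ha_of_ge (m + k) hMge, show 2 * (m + k - k) = N by omega] at h1
      have hm0 : (0 : ℝ) < ((m + k : ℕ) : ℝ) := by exact_mod_cast (show 0 < m + k by omega)
      have hm0' : (0 : ℝ) < (m : ℝ) := by exact_mod_cast (show 0 < m by omega)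
      -- `(m+k)^{-1/2} ≤ m^{-1/2} = √2 · N^{-1/2}`
      have hmono : ((m + k : ℕ) : ℝ) ^ (-(1 / 2 : ℝ)) ≤ Real.sqrt 2 * (N : ℝ) ^ (-(1 / 2 : ℝ)) := by
        rw [Real.rpow_neg hm0.le, Real.rpow_neg hN0.le, ← Real.sqrt_eq_rpow, ← Real.sqrt_eq_rpow]
        have hNm : (N : ℝ) = 2 * m := by rw [hm]; push_cast; ring
        have hs : Real.sqrt (N : ℝ) = Real.sqrt 2 * Real.sqrt m := by
          rw [hNm, Real.sqrt_mul (by norm_num : (0 : ℝ) ≤ 2)]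
        have h2pos : 0 < Real.sqrt 2 := Real.sqrt_pos.2 (by norm_num)
        rw [hs, mul_inv, ← mul_assoc, mul_inv_cancel₀ h2pos.ne', one_mul]
        exact inv_anti₀ (Real.sqrt_pos.2 hm0') (Real.sqrt_le_sqrt (by exact_mod_cast (show m ≤ m + k by omega)))
      have hpow : (μ ^ 2) ^ (m + k) = μ ^ (2 * k) * μ ^ N := by
        rw [← pow_mul, show 2 * (m + k) = 2 * k + N by omega, pow_add]
      have h2 : c * q N ≤ Real.sqrt 2 * (N : ℝ) ^ (-(1 / 2 : ℝ)) * (μ ^ (2 * k) * μ ^ N) := by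
        calc c * q N ≤ ((m + k : ℕ) : ℝ) ^ (-(1 / 2 : ℝ)) * (μ ^ 2) ^ (m + k) := h1
          _ ≤ Real.sqrt 2 * (N : ℝ) ^ (-(1 / 2 : ℝ)) * (μ ^ 2) ^ (m + k) :=
              mul_le_mul_of_nonneg_right hmono (by positivity)
          _ = Real.sqrt 2 * (N : ℝ) ^ (-(1 / 2 : ℝ)) * (μ ^ (2 * k) * μ ^ N) := by rw [hpow]
      have h3 : q N ≤ Real.sqrt 2 * μ ^ (2 * k) / c * (N : ℝ) ^ (-(1 / 2 : ℝ)) * μ ^ N := by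
        rw [div_mul_eq_mul_div, div_mul_eq_mul_div, le_div_iff₀ hc]
        calc q N * c = c * q N := mul_comm _ _
          _ ≤ Real.sqrt 2 * (N : ℝ) ^ (-(1 / 2 : ℝ)) * (μ ^ (2 * k) * μ ^ N) := h2
          _ = Real.sqrt 2 * μ ^ (2 * k) * (N : ℝ) ^ (-(1 / 2 : ℝ)) * μ ^ N := by ring
      calc q N ≤ Real.sqrt 2 * μ ^ (2 * k) / c * (N : ℝ) ^ (-(1 / 2 : ℝ)) * μ ^ N := h3
        _ ≤ (Real.sqrt 2 * μ ^ (2 * k) / c + B) * (N : ℝ) ^ (-(1 / 2 : ℝ)) * μ ^ N := by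
            nlinarith [mul_nonneg hB0 hfac0]
    · -- odd `N ≥ 3`: `q_N = 0`
      have hz : q N = 0 := hfodd N (by omega) hodd
      rw [hz]
      exact mul_nonneg (mul_nonneg (add_nonneg hA10 hB0) (by positivity)) (by positivity)
  · -- small `N`: `q_N ≤ q_N · N ≤ B`, so `q_N ≤ B · N^{-1/2} μ^N`
    have hNlt : N < N₁ := by omega
    have hqB : q N * N ≤ B := by
      rw [hB]
      exact Finset.single_le_sum (f := fun j => q j * (j : ℝ)) (fun j _ => mul_nonneg (hq0 j) (Nat.cast_nonneg _))
        (Finset.mem_range.2 hNlt)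
    have hstep : q N ≤ B * (N : ℝ) ^ (-(1 / 2 : ℝ)) * μ ^ N := by
      rw [hrpow]
      have hμN : 1 ≤ μ ^ N := one_le_pow₀ hμ1
      calc q N = q N * N * (1 / (N : ℝ)) * 1 := by field_simp
        _ ≤ q N * N * (1 / Real.sqrt N) * μ ^ N := by
            apply mul_le_mul _ hμN zero_le_one (mul_nonneg (mul_nonneg (hq0 N) hN0.le) (by positivity))
            apply mul_le_mul_of_nonneg_left _ (mul_nonneg (hq0 N) hN0.le)
            exact one_div_le_one_div_of_le hsqrtN hsqrt_le
        _ ≤ B * (1 / Real.sqrt N) * μ ^ N := by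
            apply mul_le_mul_of_nonneg_right _ (by positivity)
            exact mul_le_mul_of_nonneg_right hqB (by positivity)
    calc q N ≤ B * (N : ℝ) ^ (-(1 / 2 : ℝ)) * μ ^ N := hstep
      _ ≤ (Real.sqrt 2 * μ ^ (2 * k) / c + B) * (N : ℝ) ^ (-(1 / 2 : ℝ)) * μ ^ N := by
          nlinarith [mul_nonneg hA10 hfac0]


/-! ### The pair of output lengths -/

/-- `log (q_{2n}(ℍ) + q_{2n+2}(ℍ)) / (2n) → log μ_ℍ` (squeeze between `log q_{2n}/(2n)` and `(log 2 + max(log q_{2n}, log q_{2n+2}))/(2n)`).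
[cite: MadrasSlade1993, Corollary 3.2.5, eq. (3.2.9), p. 67 (growth constant of polygon counts); lane plumbing] -/
theorem tendsto_log_hexPolygonNumber_pair_div :
    Tendsto (fun n : ℕ => Real.log ((hexPolygonNumber (2 * n) : ℝ) + hexPolygonNumber (2 * n + 2)) / ((2 * n : ℕ) : ℝ)) atTop
      (𝓝 (Real.log hexConnectiveConstant)) := by
  set μ : ℝ := hexConnectiveConstant with hμ
  set q : ℕ → ℝ := fun N => (hexPolygonNumber N : ℝ) with hqdef
  have hq0 : ∀ N, 0 ≤ q N := fun N => Nat.cast_nonneg _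
  have hqpos : ∀ n : ℕ, 13 ≤ n → 0 < q (2 * n) := fun n hn => by
    show (0 : ℝ) < (hexPolygonNumber (2 * n) : ℝ)
    exact_mod_cast hexPolygonNumber_pos_of_even (by omega) ⟨n, by ring⟩
  -- lower bound `A n = log q_{2n} / (2n)` and the shifted `B n = log q_{2n+2} / (2n)`
  have hA : Tendsto (fun n : ℕ => Real.log (q (2 * n)) / ((2 * n : ℕ) : ℝ)) atTop (𝓝 (Real.log μ)) :=
    HV.tendsto_log_hexPolygonNumber_div
  have hB : Tendsto (fun n : ℕ => Real.log (q (2 * n + 2)) / ((2 * n : ℕ) : ℝ)) atTop (𝓝 (Real.log μ)) := by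
    have h1 : Tendsto (fun n : ℕ => Real.log (q (2 * (n + 1))) / ((2 * (n + 1) : ℕ) : ℝ)) atTop (𝓝 (Real.log μ)) :=
      HV.tendsto_log_hexPolygonNumber_div.comp (tendsto_add_atTop_nat 1)
    have h2 : Tendsto (fun n : ℕ => ((2 * (n + 1) : ℕ) : ℝ) / ((2 * n : ℕ) : ℝ)) atTop (𝓝 1) := by
      have h21 : Tendsto (fun n : ℕ => (1 : ℝ) + 1 / n) atTop (𝓝 (1 + 0)) :=
        tendsto_const_nhds.add (tendsto_const_nhds.div_atTop tendsto_natCast_atTop_atTop)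
      rw [add_zero] at h21
      refine h21.congr' ?_
      filter_upwards [eventually_ge_atTop 1] with n hn
      have hn0 : (n : ℝ) ≠ 0 := by exact_mod_cast (show n ≠ 0 by omega)
      push_cast
      field_simp
    have h3 := h1.mul h2
    rw [mul_one] at h3
    refine h3.congr' ?_
    filter_upwards [eventually_ge_atTop 1] with n hn
    have hn0 : ((2 * n : ℕ) : ℝ) ≠ 0 := by exact_mod_cast (show 2 * n ≠ 0 by omega)
    have hn1 : ((2 * (n + 1) : ℕ) : ℝ) ≠ 0 := by exact_mod_cast (show 2 * (n + 1) ≠ 0 by omega)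
    rw [show 2 * (n + 1) = 2 * n + 2 by ring] at hn1 ⊢
    field_simp
  -- upper bound `U n = log 2 / (2n) + max (A n) (B n)`
  have hU : Tendsto (fun n : ℕ => Real.log 2 / ((2 * n : ℕ) : ℝ) +
      max (Real.log (q (2 * n)) / ((2 * n : ℕ) : ℝ)) (Real.log (q (2 * n + 2)) / ((2 * n : ℕ) : ℝ))) atTop (𝓝 (Real.log μ)) := by
    have h0 : Tendsto (fun n : ℕ => Real.log 2 / ((2 * n : ℕ) : ℝ)) atTop (𝓝 0) := by
      have : Tendsto (fun n : ℕ => ((2 * n : ℕ) : ℝ)) atTop atTop := by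
        exact tendsto_natCast_atTop_atTop.comp (tendsto_id.const_mul_atTop' (by norm_num : 0 < 2))
      exact tendsto_const_nhds.div_atTop this
    have := h0.add (hA.max hB)
    simpa using this
  refine tendsto_of_tendsto_of_tendsto_of_le_of_le' hA hU ?_ ?_
  · filter_upwards [eventually_ge_atTop 13] with n hn
    have hn0 : (0 : ℝ) < ((2 * n : ℕ) : ℝ) := by exact_mod_cast (show 0 < 2 * n by omega)
    apply div_le_div_of_nonneg_right _ hn0.le
    exact Real.log_le_log (hqpos n hn) (le_add_of_nonneg_right (hq0 _))
  · filter_upwards [eventually_ge_atTop 13] with n hn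
    have hn0 : (0 : ℝ) < ((2 * n : ℕ) : ℝ) := by exact_mod_cast (show 0 < 2 * n by omega)
    have hp1 : 0 < q (2 * n) := hqpos n hn
    have hp2 : 0 < q (2 * n + 2) := by
      rw [show 2 * n + 2 = 2 * (n + 1) by ring]; exact hqpos (n + 1) (by omega)
    rw [max_div_div_right hn0.le, ← add_div]
    apply div_le_div_of_nonneg_right _ hn0.le
    -- `log (a + b) ≤ log 2 + max (log a) (log b)`
    have hle : q (2 * n) + q (2 * n + 2) ≤ 2 * max (q (2 * n)) (q (2 * n + 2)) := by
      have h1 := le_max_left (q (2 * n)) (q (2 * n + 2))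
      have h2 := le_max_right (q (2 * n)) (q (2 * n + 2))
      linarith
    have hmpos : 0 < max (q (2 * n)) (q (2 * n + 2)) := lt_max_of_lt_left hp1
    calc Real.log (q (2 * n) + q (2 * n + 2)) ≤ Real.log (2 * max (q (2 * n)) (q (2 * n + 2))) :=
          Real.log_le_log (by positivity) hle
      _ = Real.log 2 + Real.log (max (q (2 * n)) (q (2 * n + 2))) := Real.log_mul (by norm_num) hmpos.ne'
      _ = Real.log 2 + max (Real.log (q (2 * n))) (Real.log (q (2 * n + 2))) := by
          congr 1
          rcases le_total (q (2 * n)) (q (2 * n + 2)) with h | h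
          · rw [max_eq_right h, max_eq_right (Real.log_le_log hp1 h)]
          · rw [max_eq_left h, max_eq_left (Real.log_le_log hp2 h)]

/-- **Madras' bootstrap on `ℍ` with a pair of output lengths.**  If `c·√N·q_N(ℍ)² ≤ q_{2N+K}(ℍ) + q_{2N+K+2}(ℍ)` for all even `N ≥ N₀`
(`c > 0`, `K` even), then `q_N(ℍ) ≤ A · N^{−1/2} · μ_ℍ^N` for every `N ≥ 1`.  (Apply the abstract bootstrap to `f(n) := q_n + q_{n+2}`:
`(q_N + q_{N+2})² ≤ 2 q_N² + 2 q_{N+2}²`, the pair inequality at `N` and at `N + 2`, and `q_m ≤ q_{m+4}` give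
`(c/4)·√N·f(N)² ≤ f(2N + K + 4)`.)
[cite: Madras1995LatticeAnimalsExponent, §2 (primary, not held)] [cite: Hammond2015SAPJoining, §2 (arXiv v5 p. 4), §4.1 pp. 17–20]
[cite: MadrasSlade1993, Theorem 3.2.3 (3.2.3) p. 64 (monotonicity of polygon counts in the length)] -/
theorem hexPolygonNumber_le_rpow_of_joinIneq_pair {c : ℝ} {K N₀ : ℕ} (hc : 0 < c) (hK : Even K)
    (hJ : ∀ N : ℕ, N₀ ≤ N → Even N →
      c * Real.sqrt N * (hexPolygonNumber N : ℝ) ^ 2 ≤ hexPolygonNumber (2 * N + K) + hexPolygonNumber (2 * N + K + 2)) :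
    ∃ A : ℝ, ∀ N : ℕ, 1 ≤ N → (hexPolygonNumber N : ℝ) ≤ A * (N : ℝ) ^ (-(1 / 2 : ℝ)) * hexConnectiveConstant ^ N := by
  set q : ℕ → ℝ := fun N => (hexPolygonNumber N : ℝ) with hqdef
  have hq0 : ∀ N, 0 ≤ q N := fun N => Nat.cast_nonneg _
  set f : ℕ → ℝ := fun n => q n + q (n + 2) with hfdef
  have hf0 : ∀ n, 0 ≤ f n := fun n => add_nonneg (hq0 _) (hq0 _)
  have hfodd : ∀ n, 3 ≤ n → Odd n → f n = 0 := by
    intro n hn hodd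
    have h1 : (hexPolygonNumber n : ℝ) = 0 := by exact_mod_cast hexPolygonNumber_eq_zero_of_odd (by omega) hodd
    have h2 : (hexPolygonNumber (n + 2) : ℝ) = 0 := by
      exact_mod_cast hexPolygonNumber_eq_zero_of_odd (by omega) (by obtain ⟨j, hj⟩ := hodd; exact ⟨j + 1, by omega⟩)
    simp only [hfdef, hqdef, h1, h2, add_zero]
  have hfpos : ∀ m, 13 ≤ m → 0 < f (2 * m) := by
    intro m hm
    have : (0 : ℝ) < (hexPolygonNumber (2 * m) : ℝ) := by
      exact_mod_cast hexPolygonNumber_pos_of_even (by omega) ⟨m, by ring⟩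
    exact add_pos_of_pos_of_nonneg this (hq0 _)
  have hflim : Tendsto (fun n : ℕ => Real.log (f (2 * n)) / ((2 * n : ℕ) : ℝ)) atTop (𝓝 (Real.log hexConnectiveConstant)) :=
    tendsto_log_hexPolygonNumber_pair_div
  -- monotonicity `q_m ≤ q_{m+4}` (`m ≥ 3`)
  have hmono : ∀ m : ℕ, 3 ≤ m → q m ≤ q (m + 4) := fun m hm => by
    show (hexPolygonNumber m : ℝ) ≤ (hexPolygonNumber (m + 4) : ℝ)
    exact_mod_cast hexPolygonNumber_le_add_four hm
  -- the single-length inequality for `f` with `c/4` and `K + 4`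
  have hJ' : ∀ N : ℕ, max N₀ 2 ≤ N → Even N → c / 4 * Real.sqrt N * f N ^ 2 ≤ f (2 * N + (K + 4)) := by
    intro N hN hNe
    have hN0 : N₀ ≤ N := le_of_max_le_left hN
    have hN2 : 2 ≤ N := le_of_max_le_right hN
    have h1 := hJ N hN0 hNe
    have h2 := hJ (N + 2) (by omega) (by obtain ⟨j, hj⟩ := hNe; exact ⟨j + 1, by omega⟩)
    have hsqrt : Real.sqrt (N : ℝ) ≤ Real.sqrt ((N + 2 : ℕ) : ℝ) :=
      Real.sqrt_le_sqrt (by exact_mod_cast (show N ≤ N + 2 by omega))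
    have hsN : 0 ≤ Real.sqrt (N : ℝ) := Real.sqrt_nonneg _
    -- `c √N q_{N+2}² ≤ q_{2N+K+4} + q_{2N+K+6}`
    have h2' : c * Real.sqrt N * q (N + 2) ^ 2 ≤ q (2 * N + K + 4) + q (2 * N + K + 6) := by
      have := h2
      rw [show 2 * (N + 2) + K = 2 * N + K + 4 by ring, show 2 * N + K + 4 + 2 = 2 * N + K + 6 by ring] at this
      calc c * Real.sqrt N * q (N + 2) ^ 2 ≤ c * Real.sqrt ((N + 2 : ℕ) : ℝ) * q (N + 2) ^ 2 := by
            apply mul_le_mul_of_nonneg_right (mul_le_mul_of_nonneg_left hsqrt hc.le) (sq_nonneg _)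
        _ ≤ q (2 * N + K + 4) + q (2 * N + K + 6) := by push_cast at this ⊢; exact this
    have hm1 : q (2 * N + K) ≤ q (2 * N + K + 4) := hmono _ (by omega)
    have hm2 : q (2 * N + K + 2) ≤ q (2 * N + K + 6) := by
      have := hmono (2 * N + K + 2) (by omega); rw [show 2 * N + K + 2 + 4 = 2 * N + K + 6 by ring] at this; exact this
    have hsq : f N ^ 2 ≤ 2 * q N ^ 2 + 2 * q (N + 2) ^ 2 := by
      simp only [hfdef]; nlinarith [sq_nonneg (q N - q (N + 2))]
    have hfout : f (2 * N + (K + 4)) = q (2 * N + K + 4) + q (2 * N + K + 6) := by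
      simp only [hfdef]; ring_nf
    rw [hfout]
    have hcs : 0 ≤ c * Real.sqrt N := mul_nonneg hc.le hsN
    calc c / 4 * Real.sqrt N * f N ^ 2 = (c * Real.sqrt N * f N ^ 2) / 4 := by ring
      _ ≤ (c * Real.sqrt N * (2 * q N ^ 2 + 2 * q (N + 2) ^ 2)) / 4 := by
          apply div_le_div_of_nonneg_right (mul_le_mul_of_nonneg_left hsq hcs) (by norm_num)
      _ = (c * Real.sqrt N * q N ^ 2 + c * Real.sqrt N * q (N + 2) ^ 2) / 2 := by ring
      _ ≤ ((q (2 * N + K) + q (2 * N + K + 2)) + (q (2 * N + K + 4) + q (2 * N + K + 6))) / 2 := by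
          apply div_le_div_of_nonneg_right (add_le_add h1 h2') (by norm_num)
      _ ≤ ((q (2 * N + K + 4) + q (2 * N + K + 6)) + (q (2 * N + K + 4) + q (2 * N + K + 6))) / 2 := by
          apply div_le_div_of_nonneg_right _ (by norm_num); linarith
      _ = q (2 * N + K + 4) + q (2 * N + K + 6) := by ring
  have hK4 : Even (K + 4) := by obtain ⟨k, hk⟩ := hK; exact ⟨k + 2, by omega⟩
  obtain ⟨A, hA⟩ := rpow_bound_of_joinIneq_abstract (f := f) one_le_hexConnectiveConstant (by positivity : 0 < c / 4) hK4
    hf0 hfodd hfpos hflim hJ'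
  refine ⟨A, fun N hN => ?_⟩
  calc (hexPolygonNumber N : ℝ) = q N := rfl
    _ ≤ f N := le_add_of_nonneg_right (hq0 _)
    _ ≤ A * (N : ℝ) ^ (-(1 / 2 : ℝ)) * hexConnectiveConstant ^ N := hA N hN

/-- The pair bootstrap with the Duminil-Copin–Smirnov value: `q_N(ℍ) ≤ A · N^{−1/2} · √(2+√2)^N`.
[cite: Madras1995LatticeAnimalsExponent, §2] [cite: DuminilCopinSmirnov2012, Theorem 1] -/
theorem hexPolygonNumber_le_rpow_sqrt_of_joinIneq_pair {c : ℝ} {K N₀ : ℕ} (hc : 0 < c) (hK : Even K)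
    (hJ : ∀ N : ℕ, N₀ ≤ N → Even N →
      c * Real.sqrt N * (hexPolygonNumber N : ℝ) ^ 2 ≤ hexPolygonNumber (2 * N + K) + hexPolygonNumber (2 * N + K + 2)) :
    ∃ A : ℝ, ∀ N : ℕ, 1 ≤ N →
      (hexPolygonNumber N : ℝ) ≤ A * (N : ℝ) ^ (-(1 / 2 : ℝ)) * Real.sqrt (2 + Real.sqrt 2) ^ N := by
  rw [← hexConnectiveConstant_eq_of_thm1 DuminilCopinSmirnov2012_thm1_holds]
  exact hexPolygonNumber_le_rpow_of_joinIneq_pair hc hK hJ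

end HexBW

end Literature.Probability.RandomPlanarGeometry.SAW

end
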